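import Summits.ResolutionOfSingularities.ResolutionOfSingularities.Theorems.EquisingularLiftEquisingularLiftNatTowerBTransversalTransport
import Summits.ResolutionOfSingularities.ResolutionOfSingularities.Theorems.EquisingularLiftEquisingularLiftNatTowerBPointSteps
import Summits.ResolutionOfSingularities.ResolutionOfSingularities.Theorems.EquisingularLiftEquisingularLiftNatTowerPointPlaneModel
import Summits.ResolutionOfSingularities.ResolutionOfSingularities.Theorems.EquisingularLiftEquisingularLiftNatTowerInvBFourDefs
import HarnessLib

/-!
# [OURS · L1 W4.5(b) · EL♮(3) · T23-A‴] THE `Exc₄` TRANSPORT LAYER — the four `Exc₃`-level transport bricks RE-CUT AT `Tower.Exc₄`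
# (model-carrying members: no `NoRound` arm in, none out), the model-less list `Ns` (topology only), and the (F1)-birth of the new `(pt-reg)` plane at `Exc₄`

res-L1-w45b-stub-2 g13 (stub worker 2; OFFER 2026-08-28T10:17:03Z «I take the shared transport layer», unobjected; over res-L1-w45b-stub-4's (U1)
`…NatTowerInvBFourDefs` p624526 — `Tower.Exc₄`/`StageB₄`/`InvB₄` — and his ENGINE WORD v1 DRAFT 3dcf936910c4d869 §1/§3). Crux EL♮(3) =
stmt-ResolutionOfSingularities-20148 (parent EL♮ stmt-…-20038; bookkeeping node stmt-…-15660), route `EquisingularLift`, line `sections`. OURS; NOT a statement of any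
manuscript ([Hironaka2017] is a candidate under adjudication, nothing of it is asserted); AI-written, weaker than expert review. DEF-FREE; no `sorry`; standard axioms.
`--supports stmt-ResolutionOfSingularities-20148 --as helper`.

WHAT (the shared base of 027's (U2)′ point steps‴ and of the cores‴ (U3)/(U4)/(U5)). Every brick below is the ROUND-READY ARM of the named `Exc₃` brick VERBATIM
(adapted copies of res-L1-w45b-stub-4's proofs), with the `NoRound` alternative removed — in A‴ a member that cannot keep its model goes to the model-less list `Ns`:
* `Tower.exc₄_of_exc₃_of_not_noRound` (pure logic; `exc₄_exc₃` / `exc₄_forgetShadow` are stub-4's, …NatTowerInvBFourDefs);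
* `Tower.exc₄_shadow_of_disjoint` — the trivial cone `𝒦 := ⊤` next to a surface missing `closure K` (`Tower.exc₃_shadow_of_disjoint`, …NatTowerBRoundOfFact);
* `Tower.exc₄_transport_away` — B-AWAY (`Tower.exc₃_transport_away`, …NatTowerBAwayTransport): hypotheses `Disjoint D F` + «every model with trace `F` misses `C`»;
* `Tower.exc₄_pointCentre_transport` — the running surface with its shadow through a point step off it (`Tower.exc₃_pointCentre_transport`): `pt ∉ E`;
* `Tower.exc₄_transport_transversal'` — B-TRACE, full-datum dischargers (`Tower.exc₃_transport_transversal'`, …NatTowerBTransversalTransport);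
* `Tower.ns_transport` / `Tower.ns_transport_of_closed` — the model-less list through a step: closed and `T' ⊄ St F` (`not_closure_preimage_diff_subset`);
* `Tower.exc₄_newPlane_of_section(_FE)` — (F1)-birth: the new `(pt-reg)` plane is born MODEL-CARRYING (my `Tower.exc₃_newPlane_of_section`, …NatTowerPointPlaneModel
  p624223, without its `Or.inr`; local clauses = res-L1-w45b-lead-1's `pointPlane_model` p623734).
[cite: GortzWedhorn2020, Prop. 13.91 (3) and (13.19)] [cite: StacksProject, Tags 01WS, 02OS, 033B] [cite: Liu2002, Thm. 8.1.19 (b)] (method; index only).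
-/

set_option linter.dupNamespace false -- mandated namespace `Summit.<Summit>.<Problem>` of this single-conjunct summit

noncomputable section

open CategoryTheory CategoryTheory.Limits AlgebraicGeometry TopologicalSpace Topology IsLocalRing
open Literature.AlgebraicGeometry.Resolution
open AlgebraicGeometry.Scheme.IdealSheafData
open Summit.ResolutionOfSingularities.ResolutionOfSingularities.Theses.EquisingularLift.Split
open Summit.ResolutionOfSingularities.ResolutionOfSingularities.Cruxes.EquisingularLift.StrataSplit


namespace Summit.ResolutionOfSingularities.ResolutionOfSingularities.Cruxes.EquisingularLiftNat.Sections

/-! ## Pure logic -/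

section Logic

variable (O : Type) [CommRing O] (P : Scheme.{0}) (q : P ⟶ Spec (.of O)) (Y : Set P) (Ruled : Tower.RuledDatum P)
  {F₉ : Scheme.{0}} {Z₉ : Set F₉} {hZ₉ : IsClosed Z₉} {F₁₀ : Scheme.{0}} {υ' : F₁₀ ⟶ F₉}
  {G X : Scheme.{0}} {γ : G ⟶ F₁₀} {E K : Set G} {hE : IsClosed E} {σ : X ⟶ P} {jG : G ⟶ X}

/-- `Exc₃ ∧ ¬ NoRound ⇒ Exc₄`. [OURS · pure logic] -/
theorem Tower.exc₄_of_exc₃_of_not_noRound (h : Tower.Exc₃ O P q Y Ruled Z₉ hZ₉ υ' G γ E hE K X σ jG)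
    (hno : ¬ Tower.NoRound υ' G γ E) : Tower.Exc₄ O P q Y Ruled Z₉ hZ₉ υ' G γ E hE K X σ jG := by
  rcases h with h | ⟨𝓔, h1, h2, h3, h4, h5, h6⟩
  · exact absurd h hno
  · exact ⟨𝓔, h1, h2, h3, h4, h5, h6⟩

/-- **The trivial cone**: shadow-forgotten ⇒ shadow `K` whenever `E` misses `closure K` (model `𝒦 := ⊤`, local trace on `(closure K)ᶜ`);
the second arm of `Tower.exc₃_shadow_of_disjoint` (…NatTowerBRoundOfFact, res-L1-w45b-stub-4) VERBATIM. [OURS · L1 W4.5b · T23-A‴; elementary] -/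
theorem Tower.exc₄_shadow_of_disjoint (h : Tower.Exc₄ O P q Y Ruled Z₉ hZ₉ υ' G γ E hE ∅ X σ jG) (hEK : Disjoint E (closure K)) :
    Tower.Exc₄ O P q Y Ruled Z₉ hZ₉ υ' G γ E hE K X σ jG := by
  -- adapted from `Tower.exc₃_shadow_of_disjoint` (…NatTowerBRoundOfFact): the trivial cone
  obtain ⟨𝓔, he1, he2, he3, he4, he5, -⟩ := h
  refine ⟨𝓔, he1, he2, he3, he4, he5, Or.inr ⟨⊤, fun z => ?_, ?_, ?_, ?_, ?_, ?_⟩⟩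
  · rw [stalkIdeal_top]; exact ⟨⟨1, by simp⟩⟩
  · let V : G.Opens := ⟨(closure K)ᶜ, isClosed_closure.isOpen_compl⟩
    refine ⟨V, hEK.subset_compl_right, ?_⟩
    rw [Scheme.IdealSheafData.comap_top, Scheme.IdealSheafData.comap_top, eq_comm, ← Scheme.IdealSheafData.support_eq_bot_iff, eq_bot_iff]
    intro v hv
    rw [support_comap] at hv
    have hv' : (V.ι v : G) ∈ ((vanishingIdeal (⟨closure K, isClosed_closure⟩ : Closeds G)).support : Set G) := hv
    rw [Scheme.IdealSheafData.coe_support_vanishingIdeal, Scheme.Opens.ι_apply] at hv'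
    exact absurd hv' v.2
  · have htop : 𝓔 ⊔ (⊤ : X.IdealSheafData) = ⊤ := sup_top_eq _
    haveI : IsEmpty (𝓔 ⊔ (⊤ : X.IdealSheafData)).subscheme := by
      rw [← (Scheme.IdealSheafData.subschemeι _).ker_eq_top_iff_isEmpty, Scheme.IdealSheafData.ker_subschemeι]
      exact htop
    infer_instance
  · intro y hy _
    rw [sup_top_eq, Scheme.IdealSheafData.support_top] at hy
    exact absurd hy (by simp)
  · have h1 : 𝓔.comap (⊤ : X.IdealSheafData).subschemeι = ⊤ := by
      rw [← Scheme.IdealSheafData.support_eq_bot_iff, eq_bot_iff]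
      intro s _
      have h2 : (⊤ : X.IdealSheafData).subschemeι s ∈ ((⊤ : X.IdealSheafData).support : Set X) := by
        rw [← Scheme.IdealSheafData.range_subschemeι]; exact ⟨s, rfl⟩
      rw [Scheme.IdealSheafData.support_top] at h2
      exact absurd h2 (by simp)
    rw [h1]; exact isEffectiveCartier_top
  · rw [Scheme.IdealSheafData.comap_top]; exact isEffectiveCartier_top

end Logic

/-! ## B-AWAY at `Exc₄`: a model-carrying member through any step away from it -/

section Away

variable (O : Type) [CommRing O] (k : Type) [Field k] (θ : O →+* k) (P : Scheme.{0}) (q : P ⟶ Spec (.of O)) (Y : Set P)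
  (Ruled : Tower.RuledDatum P)
  {F₉ : Scheme.{0}} {Z₉ : Set F₉} {hZ₉ : IsClosed Z₉} {F₁₀ : Scheme.{0}} {υ' : F₁₀ ⟶ F₉}
  {G G' X X'' : Scheme.{0}} {γ : G ⟶ F₁₀} {σ : X ⟶ P} {jG : G ⟶ X}
  [IsLocallyNoetherian G]
  {τ : X'' ⟶ X} {C : X.IdealSheafData} (hτ : IsBlowup τ C)
  {D : Set G} {υ₂ : G' ⟶ G} {J : G.IdealSheafData} (hυ₂ : IsBlowup υ₂ J) (hJ : (J.support : Set G) = D)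
  {j₂ : G' ⟶ X''} (hcomm : j₂ ≫ τ = υ₂ ≫ jG)

include hτ hυ₂ hJ hcomm

/-- **B-AWAY at `Exc₄` — a MODEL-CARRYING member through a step whose centre misses it** (downstairs `Disjoint D F`, upstairs every model with
trace `F` misses the centre `C`): the model `𝓕` is carried to `𝓕·𝒪_{X''}`; the second arm of `Tower.exc₃_transport_away` (…NatTowerBAwayTransport,
res-L1-w45b-stub-4) VERBATIM — the `NoRound` alternative is GONE (such members are model-less, list `Ns`). [cite: GortzWedhorn2020, Prop. 13.91 (3) and (13.19)]
[cite: StacksProject, Tags 02OS, 033B] [OURS · L1 W4.5b · T23-A‴]; NOT a statement of the manuscript. -/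
theorem Tower.exc₄_transport_away
    (hRuled : ∀ (F : Set G) (𝓕 : X.IdealSheafData),
      (∃ e : (𝓕.comap τ).subscheme ≅ 𝓕.subscheme, e.hom ≫ 𝓕.subschemeι = (𝓕.comap τ).subschemeι ≫ τ) →
      Ruled F₉ Z₉ hZ₉ F₁₀ υ' G γ F X σ jG 𝓕 → Ruled F₉ Z₉ hZ₉ F₁₀ υ' G' (υ₂ ≫ γ) (closure (υ₂ ⁻¹' (F \ D))) X'' (τ ≫ σ) j₂ (𝓕.comap τ))
    {F : Set G} (hF : IsClosed F) (hExc : Tower.Exc₄ O P q Y Ruled Z₉ hZ₉ υ' G γ F hF ∅ X σ jG)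
    (hDF : Disjoint D F)
    (hdj : ∀ 𝓕 : X.IdealSheafData, 𝓕.comap jG = vanishingIdeal (⟨F, hF⟩ : Closeds G) → Disjoint (𝓕.support : Set X) (C.support : Set X)) :
    ∀ hF' : IsClosed (closure (υ₂ ⁻¹' (F \ D))),
      Tower.Exc₄ O P q Y Ruled Z₉ hZ₉ υ' G' (υ₂ ≫ γ) (closure (υ₂ ⁻¹' (F \ D))) hF' ∅ X'' (τ ≫ σ) j₂ := by
  -- adapted from `Tower.exc₃_transport_away` (…NatTowerBAwayTransport): the round-ready arm only
  intro hF'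
  obtain ⟨𝓕, he1, he2, he3, he4, he5, -⟩ := hExc
  have hd : Disjoint (𝓕.support : Set X) (C.support : Set X) := hdj 𝓕 he1
  obtain ⟨e, he⟩ := exists_iso_subscheme_comap_of_disjoint hτ 𝓕 hd
  -- downstairs: `closure υ₂⁻¹(F ∖ D) = υ₂⁻¹ F`
  have hFD : F \ D = F := sdiff_eq_left.mpr hDF.symm
  have hcl : closure (υ₂ ⁻¹' (F \ D)) = υ₂ ⁻¹' F := by
    rw [hFD]; exact (hF.preimage υ₂.continuous).closure_eq
  refine ⟨𝓕.comap τ, ?_, fun z => isPrincipal_stalkIdeal_comap τ 𝓕 z (he2 (τ z)),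
    isRegular_subscheme_comap_of_disjoint hτ 𝓕 hd he3, ?_, hRuled F 𝓕 ⟨e, he⟩ he5, Or.inl rfl⟩
  · -- (e-i) the trace: pull the reduced ideal of `F` back along `υ₂` (disjoint from the centre `D = supp J`)
    have hdisj : Disjoint ((⟨F, hF⟩ : Closeds G) : Set G) (J.support : Set G) := by rw [hJ]; exact hDF.symm
    rw [← Scheme.IdealSheafData.comap_comp, hcomm, Scheme.IdealSheafData.comap_comp, he1,
      hυ₂.comap_vanishingIdeal_of_disjoint _ hdisj]
    congr 1
    exact Closeds.ext hcl.symm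
  · -- (e-iv) off the generic point of `Y`
    rintro _ ⟨z, hz, rfl⟩
    have hz' : τ z ∈ (𝓕.support : Set X) := by rw [support_comap] at hz; exact hz
    rw [Scheme.Hom.comp_apply]
    exact he4 ⟨τ z, hz', rfl⟩

end Away

/-! ## The running surface through a point step at `Exc₄` (shadow carried) -/

section PointCentre

variable (O : Type) [CommRing O] (k : Type) [Field k] (θ : O →+* k) (P : Scheme.{0}) (q : P ⟶ Spec (.of O)) (Y : Set P)
  (Ruled : Tower.RuledDatum P)
  {F₉ : Scheme.{0}} {Z₉ : Set F₉} {hZ₉ : IsClosed Z₉} {F₁₀ : Scheme.{0}} {υ' : F₁₀ ⟶ F₉}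
  {G G' X X'' : Scheme.{0}} {γ : G ⟶ F₁₀} {E K : Set G}
  (hEcl : IsClosed E)
  {σ : X ⟶ P} {jG : G ⟶ X}
  (hExc : ∀ hE : IsClosed E, Tower.Exc₄ O P q Y Ruled Z₉ hZ₉ υ' G γ E hE K X σ jG)
  {pt : G} {D : G.IdealSheafData} (hD : (D.support : Set G) = {pt})
  {υ₂ : G' ⟶ G} (hυ₂ : IsBlowup υ₂ D) [IsLocallyNoetherian G] [IsLocallyNoetherian X] [IsLocallyNoetherian X'']
  {τ : X'' ⟶ X} {C : X.IdealSheafData} (hτ : IsBlowup τ C)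
  (hdisj : ∀ I : X.IdealSheafData, jG pt ∉ (I.support : Set X) → Disjoint (I.support : Set X) (C.support : Set X))
  {j₂ : G' ⟶ X''} {t₂ : G' ⟶ Spec (.of k)} (hcomm : j₂ ≫ τ = υ₂ ≫ jG)
  (hsq₂ : IsPullback j₂ t₂ ((τ ≫ σ) ≫ q) (Spec.map (CommRingCat.ofHom θ)))

include hEcl hExc hD hυ₂ hτ hdisj hcomm hsq₂ in
/-- **The MODEL-CARRYING running surface with its cone shadow through a point step off `E` and off `closure K`, at `Exc₄`**
(`E ↦ closure υ₂⁻¹(E ∖ {pt})`, `K ↦ closure υ₂⁻¹(K ∖ {pt})`; `𝓔, 𝒦 ↦ ·.comap τ`): the round-ready arm of `Tower.exc₃_pointCentre_transport`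
(…NatTowerBAwayTransport, res-L1-w45b-stub-4) VERBATIM. [cite: GortzWedhorn2020, Prop. 13.91 (3) and (13.19)] [cite: StacksProject, Tags 01WS, 033B]
[OURS · L1 W4.5b · T23-A‴]; NOT a statement of the manuscript. -/
theorem Tower.exc₄_pointCentre_transport
    (hRuled : ∀ (G₀ G₀' : Scheme.{0}) (γ₀ : G₀ ⟶ F₁₀) (E₀ : Set G₀) (X₀ X₀'' : Scheme.{0}) (σ₀ : X₀ ⟶ P) (j₀ : G₀ ⟶ X₀)
        (j₀' : G₀' ⟶ X₀'') (t₀' : G₀' ⟶ Spec (.of k)) (𝓔₀ : X₀.IdealSheafData) (τ₀ : X₀'' ⟶ X₀) (υ₀ : G₀' ⟶ G₀) (y₀ : G₀),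
      j₀' ≫ τ₀ = υ₀ ≫ j₀ → IsPullback j₀' t₀' ((τ₀ ≫ σ₀) ≫ q) (Spec.map (CommRingCat.ofHom θ)) → y₀ ∉ E₀ →
      (∃ e : (𝓔₀.comap τ₀).subscheme ≅ 𝓔₀.subscheme, e.hom ≫ 𝓔₀.subschemeι = (𝓔₀.comap τ₀).subschemeι ≫ τ₀) →
      Ruled F₉ Z₉ hZ₉ F₁₀ υ' G₀ γ₀ E₀ X₀ σ₀ j₀ 𝓔₀ →
      Ruled F₉ Z₉ hZ₉ F₁₀ υ' G₀' (υ₀ ≫ γ₀) (closure (υ₀ ⁻¹' (E₀ \ {y₀}))) X₀'' (τ₀ ≫ σ₀) j₀' (𝓔₀.comap τ₀))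
    (hyE : pt ∉ E) (hK : K = ∅ ∨ pt ∉ closure K) :
    ∀ hE' : IsClosed (closure (υ₂ ⁻¹' (E \ {pt}))),
      Tower.Exc₄ O P q Y Ruled Z₉ hZ₉ υ' G' (υ₂ ≫ γ) (closure (υ₂ ⁻¹' (E \ {pt}))) hE' (closure (υ₂ ⁻¹' (K \ {pt}))) X'' (τ ≫ σ) j₂ := by
  -- adapted from `Tower.exc₃_pointCentre_transport` (…NatTowerBAwayTransport): the round-ready arm only
  intro hE'
  have hE'sub : closure (υ₂ ⁻¹' (E \ {pt})) ⊆ υ₂ ⁻¹' E :=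
    closure_minimal (fun z hz => hz.1) (hEcl.preimage υ₂.continuous)
  obtain ⟨𝓔, he1, he2, he3, he4, he5, hSh⟩ := hExc hEcl
  -- transport `𝓔` (its trace is global, so it misses the centre)
  have he1' : 𝓔.comap jG = vanishingIdeal (⟨closure E, isClosed_closure⟩ : Closeds G) := by
    rw [he1]; congr 1; exact Closeds.ext hEcl.closure_eq.symm
  have hyE' : pt ∉ closure E := by rwa [hEcl.closure_eq]
  obtain ⟨hd𝓔, he, -, hregT, hprinc, htrace⟩ := fatPointStep_transport hτ hcomm hυ₂ hD hdisj 𝓔 E he1' hyE'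
  obtain ⟨e𝓔, he𝓔⟩ := he
  refine ⟨𝓔.comap τ, htrace, fun z => hprinc z (he2 (τ z)), hregT he3, ?_, ?_, ?_⟩
  · rintro _ ⟨z, hz, rfl⟩
    have hz' : τ z ∈ (𝓔.support : Set X) := by rw [support_comap] at hz; exact hz
    rw [Scheme.Hom.comp_apply]
    exact he4 ⟨τ z, hz', rfl⟩
  · exact hRuled G G' γ E X X'' σ jG j₂ t₂ 𝓔 τ υ₂ pt hcomm hsq₂ hyE ⟨e𝓔, he𝓔⟩ he5
  · -- the cone shadow with the LOCALIZED trace; the cone may meet the centre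
    rcases hK with hK0 | hyK
    · left
      rw [hK0, Set.empty_sdiff, Set.preimage_empty, closure_empty]
    rcases hSh with hK0 | ⟨𝒦, hk1, ⟨V, hEV, hk2⟩, hk3, hk4, hk5, hk6⟩
    · left
      rw [hK0, Set.empty_sdiff, Set.preimage_empty, closure_empty]
    refine Or.inr ⟨𝒦.comap τ, fun z => isPrincipal_stalkIdeal_comap τ 𝒦 z (hk1 (τ z)), ⟨υ₂ ⁻¹ᵁ V, ?_, ?_⟩, ?_, ?_, ?_, ?_⟩
    · exact hE'sub.trans (Set.preimage_mono hEV)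
    · rw [comap_comap_comap_ι_eq_of_loc hcomm hυ₂ hD 𝒦 K V hk2 hyK]
      congr 2
      exact Closeds.ext closure_closure.symm
    · rw [← Scheme.IdealSheafData.comap_sup]
      have hdEK : Disjoint (((𝓔 ⊔ 𝒦).support : Set X)) (C.support : Set X) :=
        hd𝓔.mono_left (Scheme.IdealSheafData.support_antitone (le_sup_left : 𝓔 ≤ 𝓔 ⊔ 𝒦))
      obtain ⟨e', he'⟩ := exists_iso_subscheme_comap_of_disjoint hτ (𝓔 ⊔ 𝒦) hdEK
      have hfac : ((𝓔 ⊔ 𝒦).comap τ).subschemeι ≫ (τ ≫ σ) ≫ q = e'.hom ≫ ((𝓔 ⊔ 𝒦).subschemeι ≫ σ ≫ q) := by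
        rw [← Category.assoc e'.hom, he', Category.assoc, Category.assoc]
      rw [hfac]
      haveI := hk3
      infer_instance
    · exact Tower.shadow_conditionalRegularity_transport_loc hτ hcomm hυ₂ hD 𝓔 𝒦 hd𝓔 hEcl hyE hyK he1 hEV hk2 hk4 hE'
    · exact isEffectiveCartier_comap_comap_subschemeι_of_disjoint_left hτ 𝓔 𝒦 hd𝓔 he2 hk1 hk5
    · have h1 : (𝒦.comap τ).comap (𝓔.comap τ).subschemeι = (𝒦.comap 𝓔.subschemeι).comap e𝓔.hom := by
        rw [← Scheme.IdealSheafData.comap_comp, ← Scheme.IdealSheafData.comap_comp, he𝓔]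
      rw [h1]
      exact hk6.comap_of_isOpenImmersion e𝓔.hom

end PointCentre

/-! ## B-TRACE at `Exc₄`: a model-carrying member through a round whose centre crosses it -/

section Transversal

variable (O : Type) [CommRing O] (k : Type) [Field k] (θ : O →+* k) (P : Scheme.{0}) (q : P ⟶ Spec (.of O)) (Y : Set P)
  (Ruled : Tower.RuledDatum P)
  {F₉ : Scheme.{0}} {Z₉ : Set F₉} {hZ₉ : IsClosed Z₉} {F₁₀ : Scheme.{0}} {υ' : F₁₀ ⟶ F₉}
  {G G' X X'' : Scheme.{0}} {γ : G ⟶ F₁₀} {σ : X ⟶ P} {jG : G ⟶ X}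
  [IsLocallyNoetherian X] [IsLocallyNoetherian X''] [IsIntegral X]
  {τ : X'' ⟶ X} {C : X.IdealSheafData} (hτ : IsBlowup τ C) (hXreg : Scheme.IsRegular X) (hCreg : Scheme.IsRegular C.subscheme)
  (hC0 : C ≠ ⊥)
  {D : Set G} {υ₂ : G' ⟶ G} {j₂ : G' ⟶ X''}

include hτ hXreg hCreg hC0

/-- **B-TRACE at `Exc₄`, full-datum interface** — a MODEL-CARRYING member through a round whose centre crosses it: given the snc of the
member's model with the centre (`hsnc`, (A′-1)) and the trace of its strict transform (`htrace`, (A′-3)) — both receiving every clause of the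
member's datum —, the strict transform is the new model of `closure υ₂⁻¹(F ∖ D)`. The round-ready arm of `Tower.exc₃_transport_transversal'`
(…NatTowerBTransversalTransport, res-L1-w45b-stub-4) VERBATIM. [cite: GortzWedhorn2020, Prop. 13.91 and (13.19)] [OURS · L1 W4.5b · T23-A‴];
NOT a statement of the manuscript. -/
theorem Tower.exc₄_transport_transversal'
    (hRuledSt : ∀ (F : Set G) (F' : Set G') (𝓕 : X.IdealSheafData), Ruled F₉ Z₉ hZ₉ F₁₀ υ' G γ F X σ jG 𝓕 →
      Ruled F₉ Z₉ hZ₉ F₁₀ υ' G' (υ₂ ≫ γ) F' X'' (τ ≫ σ) j₂ (strictTransformIdeal τ C 𝓕))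
    {F : Set G} (hF : IsClosed F) (hExc : Tower.Exc₄ O P q Y Ruled Z₉ hZ₉ υ' G γ F hF ∅ X σ jG)
    (hsnc : ∀ 𝓕 : X.IdealSheafData, 𝓕.comap jG = vanishingIdeal (⟨F, hF⟩ : Closeds G) →
      (∀ z : X, (stalkIdeal 𝓕 z).IsPrincipal) → Scheme.IsRegular 𝓕.subscheme →
      σ '' (𝓕.support : Set X) ⊆ {p : P | ¬ IsGenericPoint p Y} → Ruled F₉ Z₉ hZ₉ F₁₀ υ' G γ F X σ jG 𝓕 → HasSNCWith [𝓕] C)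
    (htrace : ∀ 𝓕 : X.IdealSheafData, 𝓕.comap jG = vanishingIdeal (⟨F, hF⟩ : Closeds G) →
      (∀ z : X, (stalkIdeal 𝓕 z).IsPrincipal) → Scheme.IsRegular 𝓕.subscheme →
      σ '' (𝓕.support : Set X) ⊆ {p : P | ¬ IsGenericPoint p Y} → Ruled F₉ Z₉ hZ₉ F₁₀ υ' G γ F X σ jG 𝓕 → HasSNCWith [𝓕] C →
      (strictTransformIdeal τ C 𝓕).comap j₂ =
        vanishingIdeal (⟨closure (υ₂ ⁻¹' (F \ D)), isClosed_closure⟩ : Closeds G')) :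
    ∀ hF' : IsClosed (closure (υ₂ ⁻¹' (F \ D))),
      Tower.Exc₄ O P q Y Ruled Z₉ hZ₉ υ' G' (υ₂ ≫ γ) (closure (υ₂ ⁻¹' (F \ D))) hF' ∅ X'' (τ ≫ σ) j₂ := by
  -- adapted from `Tower.exc₃_transport_transversal'` (…NatTowerBTransversalTransport): the round-ready arm only
  intro hF'
  obtain ⟨𝓕, he1, he2, he3, he4, he5, -⟩ := hExc
  have hE : HasSNCWith [𝓕] C := hsnc 𝓕 he1 he2 he3 he4 he5
  refine ⟨strictTransformIdeal τ C 𝓕, ?_, fun z => isPrincipal_stalkIdeal_strictTransformIdeal hXreg hCreg hτ hC0 𝓕 he2 z,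
    isRegular_subscheme_strictTransformIdeal_of_hasSNCWith hE hτ, ?_, hRuledSt F _ 𝓕 he5, Or.inl rfl⟩
  · -- (e-i′) the trace
    rw [htrace 𝓕 he1 he2 he3 he4 he5 hE]
  · -- (e-iv′) off the generic points of `Y`: `supp St ⊆ τ⁻¹ supp 𝓕`
    rintro _ ⟨z, hz, rfl⟩
    have hz' : τ z ∈ (𝓕.support : Set X) := by
      have h1 := support_strictTransformIdeal_subset τ C 𝓕 hz
      have hcl : closure (τ ⁻¹' ((𝓕.support : Set X) \ (C.support : Set X))) ⊆ τ ⁻¹' (𝓕.support : Set X) :=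
        closure_minimal (fun w hw => hw.1) (𝓕.support.isClosed.preimage τ.continuous)
      exact hcl h1
    rw [Scheme.Hom.comp_apply]
    exact he4 ⟨τ z, hz', rfl⟩

end Transversal

/-! ## The model-less list `Ns`: topological transport -/

section Ns

variable {G G' : Scheme.{0}} [IsLocallyNoetherian G] {υ₂ : G' ⟶ G} {D : G.IdealSheafData} (hυ₂ : IsBlowup υ₂ D)
  {T Zc : Set G} (hTirr : IsIrreducible T) (hZc : IsClosed Zc) (hTZ : ¬ T ⊆ Zc) (hDZ : (D.support : Set G) ⊆ Zc)

include hυ₂ hTirr hZc hTZ hDZ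

/-- **The model-less retained list through a step**: every member of `Ns'` that is the topological transport `closure υ₂⁻¹(F ∖ Zc)` of some
`F ∈ Ns` (closed, `T ⊄ F`) is closed with `T' ⊄ F'` — the `Ns` bookkeeping of `Tower.InvB₄` after a point step (`Zc = {pt}`) or a round (`Zc = Z`).
[OURS · L1 W4.5b · T23-A‴; pure topology over `not_closure_preimage_diff_subset`] -/
theorem Tower.ns_transport {Ns : List (Set G)} (hNs : ∀ F ∈ Ns, IsClosed F ∧ ¬ T ⊆ F) {Ns' : List (Set G')}
    (hNs' : ∀ F' ∈ Ns', ∃ F ∈ Ns, F' = closure (υ₂ ⁻¹' (F \ Zc))) :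
    ∀ F' ∈ Ns', IsClosed F' ∧ ¬ closure (υ₂ ⁻¹' (T \ Zc)) ⊆ F' := by
  intro F' hF'
  obtain ⟨F, hF, rfl⟩ := hNs' F' hF'
  exact ⟨isClosed_closure, not_closure_preimage_diff_subset hυ₂ hTirr (hNs F hF).1 hZc (hNs F hF).2 hTZ hDZ⟩

/-- **Members kept THROUGH the centre lose their model**: a member of `E :: Es ∪ Ns` (closed, `T ⊄ F`) transported topologically lands in `Ns'`
with the same bookkeeping — the source list is irrelevant. [OURS · L1 W4.5b · T23-A‴; pure topology] -/
theorem Tower.ns_transport_of_closed {F : Set G} (hF : IsClosed F) (hTF : ¬ T ⊆ F) :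
    IsClosed (closure (υ₂ ⁻¹' (F \ Zc))) ∧ ¬ closure (υ₂ ⁻¹' (T \ Zc)) ⊆ closure (υ₂ ⁻¹' (F \ Zc)) :=
  ⟨isClosed_closure, not_closure_preimage_diff_subset hυ₂ hTirr hF hZc hTF hTZ hDZ⟩

end Ns

/-! ## (F1)-birth at `Exc₄`: the new `(pt-reg)` plane is born model-carrying -/

section NewPlane

variable (O : Type) [CommRing O] (P : Scheme.{0}) (q : P ⟶ Spec (.of O)) (Y : Set P) (Ruled : Tower.RuledDatum P)
  {F₉ : Scheme.{0}} {Z₉ : Set F₉} {hZ₉ : IsClosed Z₉} {F₁₀ : Scheme.{0}} {υ' : F₁₀ ⟶ F₉}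
  {X X'' G G' : Scheme.{0}} {σ : X ⟶ P} {jG : G ⟶ X} {γ : G ⟶ F₁₀} {s : Spec (.of O) ⟶ X} {τ : X'' ⟶ X}

/-- **The new plane `υ₂⁻¹{pt}` of a `(pt-reg)` section step IS MODEL-CARRYING (`Exc₄`, shadow forgotten)** for any ruled datum holding at
`𝓔 := (ker s)·𝒪_{X''}` — `Tower.exc₃_newPlane_of_section` (…NatTowerPointPlaneModel, res-L1-w45b-stub-2) without its `Or.inr`.
[cite: Liu2002, Thm. 8.1.19 (b)] [OURS · L1 W4.5b · T23-A‴ (F1)-birth]; NOT a statement of the manuscript. -/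
theorem Tower.exc₄_newPlane_of_section [IsLocallyNoetherian X] [IsLocallyNoetherian G] (hXreg : Scheme.IsRegular X)
    (hsreg : Scheme.IsRegular s.ker.subscheme) (hsflat : Flat (s.ker.subschemeι ≫ σ ≫ q))
    (hsoff : ∀ c ∈ (s.ker.support : Set X), ¬ IsGenericPoint (σ c) Y) (hτ : IsBlowup τ s.ker)
    {pt : G} (hyc : IsClosed ({pt} : Set G)) (hGreg : IsRegularLocalRing (G.presheaf.stalk pt))
    {υ₂ : G' ⟶ G} (hυ₂ : IsBlowup υ₂ (vanishingIdeal ⟨{pt}, hyc⟩))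
    {j₂ : G' ⟶ X''} (hcomm : j₂ ≫ τ = υ₂ ≫ jG) (hCD : s.ker.comap jG = vanishingIdeal ⟨{pt}, hyc⟩)
    (hRuledBirth : Ruled F₉ Z₉ hZ₉ F₁₀ υ' G' (υ₂ ≫ γ) (υ₂ ⁻¹' {pt}) X'' (τ ≫ σ) j₂ (s.ker.comap τ))
    (hE : IsClosed (υ₂ ⁻¹' ({pt} : Set G))) :
    Tower.Exc₄ O P q Y Ruled Z₉ hZ₉ υ' G' (υ₂ ≫ γ) (υ₂ ⁻¹' {pt}) hE ∅ X'' (τ ≫ σ) j₂ := by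
  obtain ⟨𝓔, rfl, h1, h2, h3, h4, -, -⟩ := exists_planeModel (Y := Y) hXreg hsreg hsflat hsoff hτ hyc hGreg hυ₂ hcomm hCD
  exact ⟨s.ker.comap τ, h1 hE, h2, h3, h4, hRuledBirth, Or.inl rfl⟩

/-- **The same at the engine's datum `FE`.** [OURS · L1 W4.5b · T23-A‴ (F1)-birth]; NOT a statement of the manuscript. -/
theorem Tower.exc₄_newPlane_of_section_FE [IsLocallyNoetherian X] [IsLocallyNoetherian G] (hXreg : Scheme.IsRegular X)
    (hsreg : Scheme.IsRegular s.ker.subscheme) (hsflat : Flat (s.ker.subschemeι ≫ σ ≫ q))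
    (hsoff : ∀ c ∈ (s.ker.support : Set X), ¬ IsGenericPoint (σ c) Y) (hτ : IsBlowup τ s.ker)
    {pt : G} (hyc : IsClosed ({pt} : Set G)) (hGreg : IsRegularLocalRing (G.presheaf.stalk pt))
    {υ₂ : G' ⟶ G} (hυ₂ : IsBlowup υ₂ (vanishingIdeal ⟨{pt}, hyc⟩))
    {j₂ : G' ⟶ X''} (hcomm : j₂ ≫ τ = υ₂ ≫ jG) (hCD : s.ker.comap jG = vanishingIdeal ⟨{pt}, hyc⟩)
    (hE : IsClosed (υ₂ ⁻¹' ({pt} : Set G))) :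
    Tower.Exc₄ O P q Y (fun _ _ _ _ _ _ _ _ _ σ₀ _ 𝓔 => Flat (𝓔.subschemeι ≫ σ₀ ≫ q)) Z₉ hZ₉ υ' G' (υ₂ ≫ γ) (υ₂ ⁻¹' {pt}) hE ∅
      X'' (τ ≫ σ) j₂ := by
  obtain ⟨𝓔, rfl, -, -, -, -, h5, -⟩ := exists_planeModel (Y := Y) hXreg hsreg hsflat hsoff hτ hyc hGreg hυ₂ hcomm hCD
  exact Tower.exc₄_newPlane_of_section O P q Y _ hXreg hsreg hsflat hsoff hτ hyc hGreg hυ₂ hcomm hCD h5 hE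

end NewPlane

end Summit.ResolutionOfSingularities.ResolutionOfSingularities.Cruxes.EquisingularLiftNat.Sections

end
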